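import Summits.HodgeConjecture.HodgeConjecture.Theorems.MarkmanPartnerTransportPartnerExistenceSignatureReal
import Mathlib.LinearAlgebra.QuadraticForm.Signature
import Mathlib.LinearAlgebra.BilinearForm.Orthogonal

/-!
# Route MarkmanPartnerTransport · support `PartnerExistence` (stmt-HodgeConjecture-19655) —
# the orthogonal complement of a "K3-period-like" subspace of `Λ_{K3} ⊗ ℝ` contains a positive vector

The signature step of the partner construction (R2 of ROUTE-P1D §3.3: "`T(X)_ℚ ⊕ N ≅ Λ_{K3} ⊗ ℚ` for a
rational space `N` of signature `(1, ρ − 2)` … `N ∋` a positive vector"), over `ℝ`:  let `A ⊆ ℝ²²` be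
a subspace of the real K3 quadratic space `(ℝ²², ( . ))` (signature `(3,19)`) and `x₁, x₂` two vectors
(in the application the real and imaginary parts of a period in `A ⊗ ℂ`) such that `( . )` is NEGATIVE
DEFINITE on `A ∩ {x₁, x₂}^⊥` (Hodge index on the transcendental space; no hypothesis on `x₁, x₂` is
needed).  Then
**the orthogonal complement `A^⊥` contains a vector of positive square.**  Proof (Sylvester by hand):
otherwise `( . ) ≤ 0` on `A^⊥`, hence on `V = (A ∩ {x₁,x₂}^⊥) + A^⊥` (the two summands are orthogonal),
and the summands meet trivially (a vector of `A ∩ A^⊥` is isotropic, hence zero by definiteness); so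
`dim V ≥ (dim A − 2) + (22 − dim A) = 20`, contradicting `ind⁺ = 3`: the `U³`-diagonal is a positive
definite `3`-space and `ind⁺ + dim V ≤ 22` (`QuadraticForm.sigPos_add_finrank_le_of_nonpos`).

* `k3FormR_nondegenerate`, `three_le_sigPos_k3FormR` — `( . )` on `ℝ²²` is non-degenerate with `ind⁺ ≥ 3`;
* `finrank_le_nineteen_of_nonpos` — a subspace with `( . ) ≤ 0` has dimension `≤ 19`;
* `exists_pos_mem_orthogonal` — the statement above.

No definition, no sorry, no named fact. Prover seat hodge-nonav-19652-p1 (gen 5), `--supports stmt-HodgeConjecture-19655`.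

References: D. Huybrechts, *Lectures on K3 Surfaces*, Ch. 1 Prop. 3.5, Ch. 6 Prop. 1.2; D. Morrison,
Invent. Math. 75 (1984) §1; S. Lang, *Linear Algebra*, Ch. V §8 (Sylvester).
-/

noncomputable section

set_option linter.dupNamespace false

open Module QuadraticMap
open Literature.AlgebraicGeometry.Surfaces Literature.AlgebraicGeometry.Hyperkaehler
open Summit.HodgeConjecture.HodgeConjecture.Theorems.AnchorExistenceCMFloor

namespace Summit.HodgeConjecture.HodgeConjecture.Theorems.MarkmanPartnerTransport.PartnerExistenceSignature

/-! ### The real K3 form: non-degeneracy and `ind⁺ ≥ 3` -/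

/-- **The real K3 form is non-degenerate** (`det Λ_{K3} = −1`). [cite: Huybrechts2016K3, Ch. 14 §0.3 (vi)] -/
theorem k3FormR_nondegenerate : k3FormR.Nondegenerate := by
  rw [k3FormR]
  refine LinearMap.BilinForm.nondegenerate_toBilin'_of_det_ne_zero' _ ?_
  rw [← Int.cast_det, k3Gram_det]
  norm_num

/-- The real K3 form is reflexive. [folklore] -/
theorem k3FormR_isRefl : k3FormR.IsRefl := fun a b h => by rw [k3FormR_comm]; exact h

/-- **`3 ≤ ind⁺ (Λ_{K3} ⊗ ℝ)`**: the `U³`-diagonal `{E₈-coordinates 0, v_{k,0} = v_{k,1}}` is a positive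
definite `3`-space (`(v.v) = 2 Σₖ v_{k,0}²`). [cite: Huybrechts2016K3, Ch. 1 Prop. 3.5 and Ch. 14 §0.3 (vi)] -/
theorem three_le_sigPos_k3FormR : 3 ≤ sigPos k3FormR.toQuadraticMap := by
  let pr : K3Index → ((K3Index → ℝ) →ₗ[ℝ] ℝ) := fun i => LinearMap.proj i
  let f : (Fin 8 ⊕ Fin 8) → ((K3Index → ℝ) →ₗ[ℝ] ℝ) := fun e => pr (Sum.inl e)
  let g : Fin 3 → ((K3Index → ℝ) →ₗ[ℝ] ℝ) :=
    ![pr (Sum.inr (Sum.inl 0)) - pr (Sum.inr (Sum.inl 1)),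
      pr (Sum.inr (Sum.inr (Sum.inl 0))) - pr (Sum.inr (Sum.inr (Sum.inl 1))),
      pr (Sum.inr (Sum.inr (Sum.inr 0))) - pr (Sum.inr (Sum.inr (Sum.inr 1)))]
  let L : (K3Index → ℝ) →ₗ[ℝ] ((Fin 8 ⊕ Fin 8) ⊕ Fin 3 → ℝ) := LinearMap.pi (Sum.elim f g)
  have hker : 3 ≤ finrank ℝ (LinearMap.ker L) := by
    have h := LinearMap.finrank_range_add_finrank_ker L
    have hr : finrank ℝ (LinearMap.range L) ≤ 19 := by
      have := Submodule.finrank_le (LinearMap.range L)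
      rw [finrank_fintype_fun_eq_card] at this
      exact this
    rw [finrank_k3Real] at h
    omega
  have hpos : (k3FormR.toQuadraticMap.restrict (LinearMap.ker L)).PosDef := by
    rintro ⟨v, hv⟩ hv0
    rw [QuadraticMap.restrict_apply, LinearMap.BilinMap.toQuadraticMap_apply]
    have h0 : ∀ j, (Sum.elim f g) j v = 0 := fun j => by
      have := congrFun (LinearMap.mem_ker.1 hv) j
      rwa [LinearMap.pi_apply] at this
    have hE : ∀ e : Fin 8 ⊕ Fin 8, v (Sum.inl e) = 0 := fun e => by
      have := h0 (Sum.inl e)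
      simpa [f, pr] using this
    have ha := h0 (Sum.inr 0)
    have hb := h0 (Sum.inr 1)
    have hc := h0 (Sum.inr 2)
    simp only [Sum.elim_inr, g, pr, Matrix.cons_val_zero, Matrix.cons_val_one, Matrix.cons_val,
      LinearMap.sub_apply, LinearMap.coe_proj, Function.eval, sub_eq_zero] at ha hb hc
    have hR : k3FormR v v = 2 * (v (Sum.inr (Sum.inl 0)) ^ 2 + v (Sum.inr (Sum.inr (Sum.inl 0))) ^ 2 +
        v (Sum.inr (Sum.inr (Sum.inr 0))) ^ 2) := by
      rw [k3FormR_self_eq]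
      simp only [hE, ha, hb, hc, zero_mul, mul_zero, Finset.sum_const_zero, neg_zero, sub_zero, zero_add]
      ring
    have hv0' : ¬ (v (Sum.inr (Sum.inl 0)) = 0 ∧ v (Sum.inr (Sum.inr (Sum.inl 0))) = 0 ∧
        v (Sum.inr (Sum.inr (Sum.inr 0))) = 0) := by
      rintro ⟨h1, h2, h3⟩
      apply hv0
      ext i
      rcases i with (e | (k | (k | k)))
      · exact hE _
      · fin_cases k
        · exact h1
        · simpa [h1] using ha.symm
      · fin_cases k
        · exact h2
        · simpa [h2] using hb.symm
      · fin_cases k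
        · exact h3
        · simpa [h3] using hc.symm
    rw [hR]
    have : (0 : ℝ) < v (Sum.inr (Sum.inl 0)) ^ 2 + v (Sum.inr (Sum.inr (Sum.inl 0))) ^ 2 +
        v (Sum.inr (Sum.inr (Sum.inr 0))) ^ 2 := by
      by_contra hle
      rw [not_lt] at hle
      have s1 := sq_nonneg (v (Sum.inr (Sum.inl 0)))
      have s2 := sq_nonneg (v (Sum.inr (Sum.inr (Sum.inl 0))))
      have s3 := sq_nonneg (v (Sum.inr (Sum.inr (Sum.inr 0))))
      have e1 : v (Sum.inr (Sum.inl 0)) = 0 := by nlinarith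
      have e2 : v (Sum.inr (Sum.inr (Sum.inl 0))) = 0 := by nlinarith
      have e3 : v (Sum.inr (Sum.inr (Sum.inr 0))) = 0 := by nlinarith
      exact hv0' ⟨e1, e2, e3⟩
    linarith
  calc 3 ≤ finrank ℝ (LinearMap.ker L) := hker
    _ ≤ sigPos k3FormR.toQuadraticMap := le_sigPos_of_posDef _ hpos

/-- **A real subspace of `Λ_{K3} ⊗ ℝ` on which the K3 form is `≤ 0` has dimension `≤ 19`**
(`ind⁺ + dim V ≤ 22`, `ind⁺ ≥ 3`). [cite: Huybrechts2016K3, Ch. 1 Prop. 3.5] [cite: Lang1987LinearAlgebra, Ch. V §8 Thm. 8.2] -/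
theorem finrank_le_nineteen_of_nonpos (V : Submodule ℝ (K3Index → ℝ)) (hV : ∀ v ∈ V, k3FormR v v ≤ 0) :
    finrank ℝ V ≤ 19 := by
  have h := QuadraticForm.sigPos_add_finrank_le_of_nonpos (Q := k3FormR.toQuadraticMap) (V := V)
    (fun v hv => by rw [LinearMap.BilinMap.toQuadraticMap_apply]; exact hV v hv)
  have h3 := three_le_sigPos_k3FormR
  rw [finrank_k3Real] at h
  omega

/-! ### The complement of a period-like subspace contains a positive vector -/

/-- **Signature step of the K3-partner construction.**  Let `A ⊆ Λ_{K3} ⊗ ℝ` contain orthogonal vectors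
`x₁, x₂` of positive square, and let the K3 form be negative definite on `A ∩ {x₁, x₂}^⊥`.  Then `A^⊥`
contains a vector of positive square (so that, for `A = T ⊗ ℝ` the transcendental space of a prospective
K3 surface, `A^⊥ = NS ⊗ ℝ` contains an ample class and the surface is projective). [cite: Huybrechts2016K3, Ch. 1 Prop. 3.5 and Ch. 6 Prop. 1.2]
[cite: Morrison1984, §1 (Thm. 1.14 and Cor. 1.9)] -/
theorem exists_pos_mem_orthogonal (A : Submodule ℝ (K3Index → ℝ)) (x₁ x₂ : K3Index → ℝ)
    (hneg : ∀ v ∈ A, k3FormR v x₁ = 0 → k3FormR v x₂ = 0 → v ≠ 0 → k3FormR v v < 0) :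
    ∃ m ∈ k3FormR.orthogonal A, 0 < k3FormR m m := by
  by_contra hcon
  push Not at hcon
  -- `M = A^⊥`, `dim M = 22 - dim A`
  set M := k3FormR.orthogonal A with hMdef
  have hMfin : finrank ℝ M = 22 - finrank ℝ A := by
    rw [hMdef, LinearMap.BilinForm.finrank_orthogonal k3FormR_nondegenerate, finrank_k3Real]
  have hAle : finrank ℝ A ≤ 22 := by rw [← finrank_k3Real]; exact Submodule.finrank_le A
  -- `A₋ = A ∩ x₁^⊥ ∩ x₂^⊥` as the image of the kernel of `(( . x₁), ( . x₂))` restricted to `A`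
  let ℓ : Fin 2 → ((K3Index → ℝ) →ₗ[ℝ] ℝ) := ![k3FormR x₁, k3FormR x₂]
  let g : A →ₗ[ℝ] (Fin 2 → ℝ) := (LinearMap.pi ℓ).domRestrict A
  set Am := (LinearMap.ker g).map A.subtype with hAmdef
  have hAm_mem : ∀ v, v ∈ Am ↔ v ∈ A ∧ k3FormR v x₁ = 0 ∧ k3FormR v x₂ = 0 := by
    intro v
    constructor
    · rintro ⟨w, hw, rfl⟩
      have hw' : ∀ k, ℓ k (w : K3Index → ℝ) = 0 := fun k => by
        have := congrFun (LinearMap.mem_ker.1 hw) k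
        rwa [LinearMap.domRestrict_apply, LinearMap.pi_apply] at this
      have e1 := hw' 0
      have e2 := hw' 1
      simp only [ℓ, Matrix.cons_val_zero, Matrix.cons_val_one] at e1 e2
      exact ⟨w.2, by rw [k3FormR_comm]; exact e1, by rw [k3FormR_comm]; exact e2⟩
    · rintro ⟨hvA, e1, e2⟩
      refine ⟨⟨v, hvA⟩, ?_, rfl⟩
      rw [SetLike.mem_coe, LinearMap.mem_ker]
      funext k
      rw [LinearMap.domRestrict_apply, LinearMap.pi_apply, Pi.zero_apply]
      fin_cases k
      · simpa [ℓ, k3FormR_comm] using e1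
      · simpa [ℓ, k3FormR_comm] using e2
  have hAmfin : finrank ℝ A ≤ finrank ℝ Am + 2 := by
    have h1 : finrank ℝ Am = finrank ℝ (LinearMap.ker g) :=
      LinearEquiv.finrank_eq (Submodule.equivMapOfInjective _ A.injective_subtype _).symm
    have h2 := LinearMap.finrank_range_add_finrank_ker g
    have h3 : finrank ℝ (LinearMap.range g) ≤ 2 := by
      have := Submodule.finrank_le (LinearMap.range g)
      rwa [finrank_fintype_fun_eq_card, Fintype.card_fin] at this
    rw [h1]
    omega
  -- `( . ) ≤ 0` on `V = A₋ + M`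
  have hVnonpos : ∀ v ∈ Am ⊔ M, k3FormR v v ≤ 0 := by
    intro v hv
    obtain ⟨s, hs, m, hm, rfl⟩ := Submodule.mem_sup.1 hv
    obtain ⟨hsA, hs1, hs2⟩ := (hAm_mem s).1 hs
    have hsm : k3FormR s m = 0 := (LinearMap.BilinForm.mem_orthogonal_iff.1 hm) s hsA
    have hms : k3FormR m s = 0 := by rw [k3FormR_comm]; exact hsm
    have hss : k3FormR s s ≤ 0 := by
      by_cases hs0 : s = 0
      · simp [hs0]
      · exact (hneg s hsA hs1 hs2 hs0).le
    have hmm : k3FormR m m ≤ 0 := hcon m hm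
    simp only [map_add, LinearMap.add_apply, hsm, hms]
    linarith
  -- `A₋ ∩ M = 0`
  have hdisj : Am ⊓ M = ⊥ := by
    rw [eq_bot_iff]
    intro v hv
    obtain ⟨hvAm, hvM⟩ := Submodule.mem_inf.1 hv
    obtain ⟨hvA, hv1, hv2⟩ := (hAm_mem v).1 hvAm
    rw [Submodule.mem_bot]
    by_contra hv0
    have hlt := hneg v hvA hv1 hv2 hv0
    have hvv : k3FormR v v = 0 := (LinearMap.BilinForm.mem_orthogonal_iff.1 hvM) v hvA
    rw [hvv] at hlt
    exact lt_irrefl _ hlt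
  -- dimension count
  have hsum := Submodule.finrank_sup_add_finrank_inf_eq Am M
  rw [hdisj, finrank_bot, add_zero] at hsum
  have h19 := finrank_le_nineteen_of_nonpos _ hVnonpos
  omega

end Summit.HodgeConjecture.HodgeConjecture.Theorems.MarkmanPartnerTransport.PartnerExistenceSignature

end
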